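import Literature.Analysis.Complex.SeveralVariables
import Mathlib.Analysis.Distribution.SchwartzSpace.Deriv
import Mathlib.Analysis.InnerProductSpace.PiL2
import Mathlib.Analysis.Calculus.LineDeriv.IntegrationByParts
import Mathlib.MeasureTheory.Integral.CircleIntegral
import HarnessLib

/-!
# Iterated coordinate derivatives of holomorphic functions on polydiscs: Cauchy bounds, parameters, real restriction

Analysis/Complex support file. For functions `G : (ι → ℂ) → ℂ` holomorphic on a sup-norm ball
(= polydisc with equal radii) of `ℂ^ι` we set up the **iterated coordinate derivatives**
`cderivIter J G` along a multi-index `J : Fin n → ι` — with the recursion "differentiate in the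
direction `J 0` first, then along `tail J`", the order in which integration by parts peels off
iterated directional derivatives `∂^{e_J} ψ = ∂_{e_{J 0}} ∂^{e_{tail J}} ψ` of a test function — and
prove:

* `differentiableOn_cderivIter` — they are holomorphic on the same ball
  (`Literature.Analysis.Complex.SCV.differentiableOn_fderiv_apply`);
* `norm_cderivIter_le` — **Cauchy bounds on shrinking polydiscs**: `‖G‖ ≤ M` on `ball z₀ R` gives
  `‖cderivIter J G‖ ≤ M s⁻ⁿ` on `ball z₀ (R - n s)` (`n = |J|`, one variable at a time,
  `Literature.Analysis.Complex.SCV.norm_fderiv_apply_le`);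
* `continuousOn_cderivIter_param` — **joint continuity in a real parameter**: if
  `(t, z) ↦ G t z` is continuous on `S ×ˢ ball z₀ R` and each `G t` is holomorphic, then so is
  `(t, z) ↦ cderivIter J (G t) z` on `S ×ˢ ball z₀ (R - n s)` (Cauchy's formula for a coordinate
  derivative as a circle integral, continuity of parametric interval integrals);
* the **real restriction** `x ↦ G (eRealPt x)`, `eRealPt x = (xᵢ)ᵢ ∈ ℂ^ι` for `x` in
  `EuclideanSpace ℝ ι`: its directional derivative along the basis vector `eⱼ` is the complex
  coordinate derivative (`hasLineDerivAt_comp_eRealPt`), and **integration by parts against a test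
  function supported in the real ball**,
  `∫ G(x) ∂^{e_J}ψ(x) dx = (-1)ⁿ ∫ (cderivIter J G)(x) ψ(x) dx` (`integral_comp_eRealPt_mul_iteratedLineDerivOp`).

These are the several-variable ingredients of the analytic deconvolution lemma
(`AnalyticDeconvolution.lean`), where holomorphic extensions of regularised distributions are
bounded on fixed polydiscs and their derivatives must be controlled uniformly in the
regularisation (Osterwalder–Schrader II, Comm. Math. Phys. 42 (1975), Ch. VI.1, p. 300: "we can use
the maximum principle … This bound holds uniformly in the parameters").

## References

* L. Hörmander, *An Introduction to Complex Analysis in Several Variables* (3rd ed. 1990),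
  Thm. 2.2.1 and Cor. 2.2.5 (Cauchy's formula and inequalities in polydiscs).
* K. Osterwalder, R. Schrader, *Axioms for Euclidean Green's functions II*, Comm. Math. Phys. 42
  (1975) 281–305, Ch. VI.1. [OsterwalderSchraderCMP1975]

Everything here is standard and tagged folklore.
-/

noncomputable section

open MeasureTheory Filter Set Metric Complex SchwartzMap
open scoped Topology LineDeriv Real

namespace Literature.Analysis.Complex

variable {ι : Type*}

/-! ### Coordinate vectors and real points of `ℂ^ι` -/

/-- The `j`-th complex coordinate vector `E_j = (δᵢⱼ)ᵢ ∈ ℂ^ι`. [folklore] -/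
def cxUnit [DecidableEq ι] (j : ι) : ι → ℂ := Pi.single j 1

/-- `‖E_j‖ = 1` (sup norm). [folklore] -/
@[simp]
theorem norm_cxUnit [Fintype ι] [DecidableEq ι] (j : ι) : ‖(cxUnit j : ι → ℂ)‖ = 1 := by
  rw [cxUnit, Pi.norm_single, norm_one]

/-- The real point `(xᵢ)ᵢ ∈ ℂ^ι` of `x ∈ ℝ^ι` (Euclidean space). [folklore] -/
def eRealPt (x : EuclideanSpace ℝ ι) : ι → ℂ := fun i => ((x i : ℝ) : ℂ)

/-- Coordinates of a real point. [folklore] -/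
@[simp]
theorem eRealPt_apply (x : EuclideanSpace ℝ ι) (i : ι) : eRealPt x i = ((x i : ℝ) : ℂ) := rfl

/-- `eRealPt` is additive. [folklore] -/
theorem eRealPt_add (x y : EuclideanSpace ℝ ι) : eRealPt (x + y) = eRealPt x + eRealPt y := by
  funext i; simp [eRealPt]

/-- `eRealPt` is `ℝ`-homogeneous. [folklore] -/
theorem eRealPt_smul (t : ℝ) (x : EuclideanSpace ℝ ι) : eRealPt (t • x) = (t : ℂ) • eRealPt x := by
  funext i; simp [eRealPt]

/-- The real basis vector goes to the complex coordinate vector. [folklore] -/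
theorem eRealPt_single [DecidableEq ι] (j : ι) : eRealPt (EuclideanSpace.single j (1 : ℝ)) = cxUnit j := by
  funext i
  simp only [eRealPt, cxUnit, Pi.single_apply, PiLp.single_apply]
  split_ifs <;> simp

/-- **`eRealPt` is `1`-Lipschitz from the Euclidean to the sup norm**: `‖eRealPt x − eRealPt y‖ ≤ ‖x − y‖`.
[folklore] -/
theorem norm_eRealPt_sub_le [Fintype ι] (x y : EuclideanSpace ℝ ι) : ‖eRealPt x - eRealPt y‖ ≤ ‖x - y‖ := by
  refine (pi_norm_le_iff_of_nonneg (norm_nonneg _)).2 fun i => ?_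
  rw [Pi.sub_apply, eRealPt_apply, eRealPt_apply, ← Complex.ofReal_sub, Complex.norm_real]
  have h := PiLp.norm_apply_le (x - y) i
  simpa using h

/-- Real balls go into complex polydiscs. [folklore] -/
theorem eRealPt_mem_ball [Fintype ι] {x₀ x : EuclideanSpace ℝ ι} {r : ℝ} (hx : x ∈ Metric.ball x₀ r) :
    eRealPt x ∈ Metric.ball (eRealPt x₀) r := by
  rw [Metric.mem_ball, dist_eq_norm] at hx ⊢
  exact lt_of_le_of_lt (norm_eRealPt_sub_le x x₀) hx

/-- `eRealPt` is continuous. [folklore] -/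
theorem continuous_eRealPt : Continuous (eRealPt : EuclideanSpace ℝ ι → ι → ℂ) :=
  continuous_pi fun i => Complex.continuous_ofReal.comp (PiLp.continuous_apply 2 _ i)

/-! ### Iterated coordinate derivatives -/

/-- **Iterated coordinate derivatives** along a multi-index, first index first:
`D^J G = D^{tail J} (∂_{J 0} G)`, `∂_j G = (z ↦ DG(z) E_j)`. [folklore] -/
def cderivIter [DecidableEq ι] : {n : ℕ} → (Fin n → ι) → ((ι → ℂ) → ℂ) → (ι → ℂ) → ℂ
  | 0, _, G => G
  | _ + 1, J, G => cderivIter (Fin.tail J) fun z => fderiv ℂ G z (cxUnit (J 0))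

/-- Zero multi-index. [folklore] -/
@[simp]
theorem cderivIter_zero [DecidableEq ι] (J : Fin 0 → ι) (G : (ι → ℂ) → ℂ) : cderivIter J G = G := rfl

/-- Successor multi-index. [folklore] -/
theorem cderivIter_succ [DecidableEq ι] {n : ℕ} (J : Fin (n + 1) → ι) (G : (ι → ℂ) → ℂ) :
    cderivIter J G = cderivIter (Fin.tail J) (fun z => fderiv ℂ G z (cxUnit (J 0))) := rfl

variable [Fintype ι] [DecidableEq ι]

/-- A translate of a point of `ball z₀ (R - s)` by `t E_j`, `|t| ≤ s`, stays in `ball z₀ R`. [folklore] -/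
theorem add_smul_cxUnit_mem_ball {z₀ z : ι → ℂ} {R s : ℝ} (hz : z ∈ ball z₀ (R - s)) (j : ι)
    {t : ℂ} (ht : t ∈ closedBall (0 : ℂ) s) : z + t • cxUnit j ∈ ball z₀ R := by
  rw [mem_ball, dist_eq_norm] at hz ⊢
  rw [mem_closedBall, dist_zero_right] at ht
  calc ‖z + t • cxUnit j - z₀‖ = ‖(z - z₀) + t • cxUnit j‖ := by congr 1; abel
    _ ≤ ‖z - z₀‖ + ‖t • cxUnit j‖ := norm_add_le _ _
    _ = ‖z - z₀‖ + ‖t‖ := by rw [norm_smul, norm_cxUnit, mul_one]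
    _ < R - s + s := add_lt_add_of_lt_of_le hz ht
    _ = R := by ring

/-- **One coordinate derivative: holomorphy and the Cauchy bound on a shrunk polydisc.** If `G` is
holomorphic on `ball z₀ R` with `‖G‖ ≤ M` there, then `∂_j G` is holomorphic on `ball z₀ R` and
`‖∂_j G‖ ≤ M / s` on `ball z₀ (R - s)` (`s > 0`). [folklore] -/
theorem norm_fderiv_cxUnit_le {G : (ι → ℂ) → ℂ} {z₀ : ι → ℂ} {R M s : ℝ} (hs : 0 < s)
    (hG : DifferentiableOn ℂ G (ball z₀ R)) (hM : ∀ z ∈ ball z₀ R, ‖G z‖ ≤ M) (j : ι) {z : ι → ℂ}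
    (hz : z ∈ ball z₀ (R - s)) : ‖fderiv ℂ G z (cxUnit j)‖ ≤ M / s :=
  SCV.norm_fderiv_apply_le hG isOpen_ball hs (fun _ ht => add_smul_cxUnit_mem_ball hz j ht)
    fun _ ht => hM _ (add_smul_cxUnit_mem_ball hz j (sphere_subset_closedBall ht))

/-- **Holomorphy of the iterated coordinate derivatives.** [folklore] -/
theorem differentiableOn_cderivIter {z₀ : ι → ℂ} {R : ℝ} :
    ∀ {n : ℕ} (J : Fin n → ι) {G : (ι → ℂ) → ℂ}, DifferentiableOn ℂ G (ball z₀ R) →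
      DifferentiableOn ℂ (cderivIter J G) (ball z₀ R)
  | 0, _, _, hG => hG
  | _ + 1, J, _, hG => differentiableOn_cderivIter (Fin.tail J)
      (SCV.differentiableOn_fderiv_apply hG isOpen_ball (cxUnit (J 0)))

/-- **Cauchy bounds for the iterated coordinate derivatives on shrinking polydiscs**:
`‖G‖ ≤ M` on `ball z₀ R` gives `‖D^J G‖ ≤ M (s⁻¹)ⁿ` on `ball z₀ (R - n s)`. [folklore] -/
theorem norm_cderivIter_le {z₀ : ι → ℂ} {s : ℝ} (hs : 0 < s) :
    ∀ {n : ℕ} (J : Fin n → ι) {G : (ι → ℂ) → ℂ} {R M : ℝ}, DifferentiableOn ℂ G (ball z₀ R) →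
      (∀ z ∈ ball z₀ R, ‖G z‖ ≤ M) →
      ∀ z ∈ ball z₀ (R - n * s), ‖cderivIter J G z‖ ≤ M * (s⁻¹) ^ n
  | 0, _, _, _, _, _, hM, z, hz => by
    simpa using hM z (by simpa using hz)
  | n + 1, J, G, R, M, hG, hM, z, hz => by
    rw [cderivIter_succ]
    have hG' : DifferentiableOn ℂ (fun z => fderiv ℂ G z (cxUnit (J 0))) (ball z₀ (R - s)) :=
      (SCV.differentiableOn_fderiv_apply hG isOpen_ball (cxUnit (J 0))).mono
        (ball_subset_ball (by linarith))
    have hM' : ∀ z ∈ ball z₀ (R - s), ‖fderiv ℂ G z (cxUnit (J 0))‖ ≤ M / s := fun z hz =>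
      norm_fderiv_cxUnit_le hs hG hM (J 0) hz
    have hz' : z ∈ ball z₀ (R - s - n * s) := by
      convert hz using 2; push_cast; ring
    have h := norm_cderivIter_le hs (Fin.tail J) hG' hM' z hz'
    calc ‖cderivIter (Fin.tail J) (fun z => fderiv ℂ G z (cxUnit (J 0))) z‖ ≤ M / s * s⁻¹ ^ n := h
      _ = M * s⁻¹ ^ (n + 1) := by rw [pow_succ]; ring

/-! ### Joint continuity in a parameter -/

/-- **Coordinate derivatives of a jointly continuous holomorphic family are jointly continuous**
(one derivative, polydisc shrunk by `s`): Cauchy's formula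
`∂_j G_t(z) = (2πi)⁻¹ ∮_{|ζ| = s/2} ζ⁻² G_t(z + ζ E_j) dζ` and continuity of parametric interval
integrals. [folklore] -/
theorem continuousOn_fderiv_cxUnit_param {X : Type*} [TopologicalSpace X] {S : Set X}
    {G : X → (ι → ℂ) → ℂ} {z₀ : ι → ℂ} {R s : ℝ} (hs : 0 < s)
    (hcont : ContinuousOn (fun q : X × (ι → ℂ) => G q.1 q.2) (S ×ˢ ball z₀ R))
    (hdiff : ∀ t ∈ S, DifferentiableOn ℂ (G t) (ball z₀ R)) (j : ι) :
    ContinuousOn (fun q : X × (ι → ℂ) => fderiv ℂ (G q.1) q.2 (cxUnit j)) (S ×ˢ ball z₀ (R - s)) := by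
  set A : Set (X × (ι → ℂ)) := S ×ˢ ball z₀ (R - s) with hA
  set ρ : ℝ := s / 2 with hρ
  have hρpos : 0 < ρ := by positivity
  -- the circle-integral representation on `A`
  set Φ : X × (ι → ℂ) → ℂ := fun q => (2 * π * I)⁻¹ • ∫ θ in (0 : ℝ)..2 * π,
    deriv (circleMap 0 ρ) θ • ((1 / circleMap 0 ρ θ ^ 2) • G q.1 (q.2 + circleMap 0 ρ θ • cxUnit j))
    with hΦ
  have hmem : ∀ q ∈ A, ∀ t ∈ closedBall (0 : ℂ) ρ, q.2 + t • cxUnit j ∈ ball z₀ R := by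
    rintro ⟨x, z⟩ hq t ht
    have hz : z ∈ ball z₀ (R - ρ) := ball_subset_ball (by rw [hρ]; linarith) (mem_prod.1 hq).2
    exact add_smul_cxUnit_mem_ball hz j ht
  have hrepr : ∀ q ∈ A, fderiv ℂ (G q.1) q.2 (cxUnit j) = Φ q := by
    intro q hq
    rw [hΦ]
    dsimp only
    rw [SCV.fderiv_apply_eq_smul_circleIntegral (hdiff q.1 (mem_prod.1 hq).1) isOpen_ball hρpos
      (hmem q hq)]
    rfl
  refine ContinuousOn.congr ?_ hrepr
  -- continuity of `Φ` on `A` through the subtype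
  rw [continuousOn_iff_continuous_restrict]
  have h1 : Continuous fun p : A × ℝ => circleMap 0 ρ p.2 :=
    (continuous_circleMap 0 ρ).comp continuous_snd
  have hderiv : Continuous fun p : A × ℝ => deriv (circleMap 0 ρ) p.2 := by
    simp_rw [deriv_circleMap]
    exact h1.mul continuous_const
  have hinv : Continuous fun p : A × ℝ => (1 / circleMap 0 ρ p.2 ^ 2 : ℂ) :=
    continuous_const.div (h1.pow 2) fun p => pow_ne_zero _ (circleMap_ne_center hρpos.ne')
  have hinner : Continuous fun p : A × ℝ =>
      ((p.1 : X × (ι → ℂ)).1, (p.1 : X × (ι → ℂ)).2 + circleMap 0 ρ p.2 • cxUnit j) :=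
    (continuous_fst.comp (continuous_subtype_val.comp continuous_fst)).prodMk
      ((continuous_snd.comp (continuous_subtype_val.comp continuous_fst)).add
        (h1.smul continuous_const))
  have hGp : Continuous fun p : A × ℝ =>
      G (p.1 : X × (ι → ℂ)).1 ((p.1 : X × (ι → ℂ)).2 + circleMap 0 ρ p.2 • cxUnit j) :=
    hcont.comp_continuous hinner fun p =>
      mem_prod.2 ⟨(mem_prod.1 p.1.2).1, hmem p.1 p.1.2 _ (circleMap_mem_closedBall _ hρpos.le _)⟩
  have hF : Continuous (Function.uncurry fun (q : A) (θ : ℝ) =>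
      deriv (circleMap 0 ρ) θ • ((1 / circleMap 0 ρ θ ^ 2) •
        G (q : X × (ι → ℂ)).1 ((q : X × (ι → ℂ)).2 + circleMap 0 ρ θ • cxUnit j))) := by
    change Continuous fun p : A × ℝ => deriv (circleMap 0 ρ) p.2 • ((1 / circleMap 0 ρ p.2 ^ 2) •
      G (p.1 : X × (ι → ℂ)).1 ((p.1 : X × (ι → ℂ)).2 + circleMap 0 ρ p.2 • cxUnit j))
    exact hderiv.smul (hinv.smul hGp)
  have h := (intervalIntegral.continuous_parametric_intervalIntegral_of_continuous' (μ := volume) hF 0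
    (2 * π)).const_smul ((2 * π * I)⁻¹ : ℂ)
  exact h

/-- **Joint continuity of the iterated coordinate derivatives** of a jointly continuous holomorphic
family, on `S ×ˢ ball z₀ (R - n s)`. [folklore] -/
theorem continuousOn_cderivIter_param {X : Type*} [TopologicalSpace X] {S : Set X} {z₀ : ι → ℂ}
    {s : ℝ} (hs : 0 < s) :
    ∀ {n : ℕ} (J : Fin n → ι) {G : X → (ι → ℂ) → ℂ} {R : ℝ},
      ContinuousOn (fun q : X × (ι → ℂ) => G q.1 q.2) (S ×ˢ ball z₀ R) →
      (∀ t ∈ S, DifferentiableOn ℂ (G t) (ball z₀ R)) →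
      ContinuousOn (fun q : X × (ι → ℂ) => cderivIter J (G q.1) q.2) (S ×ˢ ball z₀ (R - n * s))
  | 0, _, _, _, hc, _ => by simpa using hc
  | n + 1, J, G, R, hc, hd => by
    have hc' := continuousOn_fderiv_cxUnit_param hs hc hd (J 0)
    have hd' : ∀ t ∈ S, DifferentiableOn ℂ (fun z => fderiv ℂ (G t) z (cxUnit (J 0))) (ball z₀ (R - s)) :=
      fun t ht => (SCV.differentiableOn_fderiv_apply (hd t ht) isOpen_ball _).mono
        (ball_subset_ball (by linarith))
    have h := continuousOn_cderivIter_param hs (Fin.tail J) (G := fun t z => fderiv ℂ (G t) z (cxUnit (J 0)))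
      hc' hd'
    have hR : R - s - n * s = R - (n + 1 : ℕ) * s := by push_cast; ring
    rw [hR] at h
    simpa [cderivIter_succ] using h

/-! ### Real restriction and integration by parts -/

/-- **The real directional derivative of the real restriction is the complex coordinate
derivative**: for `G` complex differentiable at `eRealPt x`,
`∂_{eⱼ} (G ∘ eRealPt)(x) = DG(eRealPt x) E_j`. [folklore] -/
theorem hasLineDerivAt_comp_eRealPt {G : (ι → ℂ) → ℂ} {x : EuclideanSpace ℝ ι}
    (hG : DifferentiableAt ℂ G (eRealPt x)) (j : ι) :
    HasLineDerivAt ℝ (fun y => G (eRealPt y)) (fderiv ℂ G (eRealPt x) (cxUnit j)) x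
      (EuclideanSpace.single j (1 : ℝ)) := by
  unfold HasLineDerivAt
  have hfun : (fun t : ℝ => G (eRealPt (x + t • EuclideanSpace.single j (1 : ℝ)))) =
      fun t : ℝ => (fun w : ℂ => G (eRealPt x + w • cxUnit j)) (t : ℂ) := by
    funext t
    rw [eRealPt_add, eRealPt_smul, eRealPt_single]
  rw [hfun]
  have h := SCV.hasDerivAt_slice_zero hG (cxUnit j)
  rw [← Complex.ofReal_zero] at h
  exact h.comp_ofReal

omit [DecidableEq ι] in
/-- A test function supported in a ball has compact support. [folklore] -/
theorem hasCompactSupport_of_tsupport_subset_ball {ψ : EuclideanSpace ℝ ι → ℂ}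
    {x₀ : EuclideanSpace ℝ ι} {r : ℝ} (h : tsupport ψ ⊆ Metric.ball x₀ r) : HasCompactSupport ψ :=
  IsCompact.of_isClosed_subset (isCompact_closedBall x₀ r) (isClosed_tsupport _)
    (h.trans ball_subset_closedBall)

/-- A product `f ϕ` with `f` continuous on an open set containing the topological support of the
continuous function `ϕ` is continuous (it vanishes near every other point). [folklore] -/
theorem continuous_mul_of_continuousOn_of_tsupport_subset {Y : Type*} [TopologicalSpace Y]
    {f ϕ : Y → ℂ} {U : Set Y} (hU : IsOpen U) (hf : ContinuousOn f U) (hϕ : Continuous ϕ)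
    (hsupp : tsupport ϕ ⊆ U) : Continuous fun y => f y * ϕ y := by
  refine continuous_iff_continuousAt.2 fun y => ?_
  by_cases hy : y ∈ tsupport ϕ
  · exact ((hf y (hsupp hy)).continuousAt (hU.mem_nhds (hsupp hy))).mul hϕ.continuousAt
  · -- `ϕ = 0` near `y`
    have hev : (fun y => f y * ϕ y) =ᶠ[𝓝 y] fun _ => 0 := by
      have : ϕ =ᶠ[𝓝 y] 0 := by
        rwa [← notMem_tsupport_iff_eventuallyEq] 
      filter_upwards [this] with y' hy'
      simp [hy']
    exact (continuousAt_const.congr hev.symm :)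

/-- **Integration by parts against a test function supported in the real ball, iterated**: for `G`
holomorphic on the complex polydisc `ball (eRealPt x₀) r` and `ψ` with `tsupport ψ ⊆ ball x₀ r`,
`∫ G(eRealPt x) ∂^{e_J}ψ(x) dx = (-1)ⁿ ∫ (D^J G)(eRealPt x) ψ(x) dx` (`n = |J|`; Mathlib's
`integral_bilinear_hasLineDerivAt_right_eq_neg_left_of_integrable`, which asks differentiability
of the first factor only on the support of the second). [folklore] -/
theorem integral_comp_eRealPt_mul_iteratedLineDerivOp {x₀ : EuclideanSpace ℝ ι} {r : ℝ} :
    ∀ {n : ℕ} (J : Fin n → ι) {G : (ι → ℂ) → ℂ}, DifferentiableOn ℂ G (ball (eRealPt x₀) r) →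
      ∀ (ψ : 𝓢(EuclideanSpace ℝ ι, ℂ)), tsupport (ψ : EuclideanSpace ℝ ι → ℂ) ⊆ Metric.ball x₀ r →
        ∫ x, G (eRealPt x) * (∂^{fun i => EuclideanSpace.single (J i) (1 : ℝ)} ψ) x =
          (-1) ^ n * ∫ x, cderivIter J G (eRealPt x) * ψ x
  | 0, _, _, _, ψ, _ => by simp [LineDeriv.iteratedLineDerivOp_fin_zero]
  | n + 1, J, G, hG, ψ, hψ => by
    rw [LineDeriv.iteratedLineDerivOp_succ_left, cderivIter_succ]
    set ϕ : 𝓢(EuclideanSpace ℝ ι, ℂ) := ∂^{Fin.tail fun i => EuclideanSpace.single (J i) (1 : ℝ)} ψ with hϕ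
    set v : EuclideanSpace ℝ ι := EuclideanSpace.single (J 0) (1 : ℝ) with hv
    set G₁ : (ι → ℂ) → ℂ := fun z => fderiv ℂ G z (cxUnit (J 0)) with hG₁
    have hϕsupp : tsupport (ϕ : EuclideanSpace ℝ ι → ℂ) ⊆ Metric.ball x₀ r :=
      (tsupport_iteratedLineDerivOp_subset _ ψ).trans hψ
    have hG₁d : DifferentiableOn ℂ G₁ (ball (eRealPt x₀) r) :=
      SCV.differentiableOn_fderiv_apply hG isOpen_ball _
    -- the real restrictions are continuous on the real ball
    have hU : IsOpen (Metric.ball x₀ r) := Metric.isOpen_ball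
    have hGc : ContinuousOn (fun x : EuclideanSpace ℝ ι => G (eRealPt x)) (Metric.ball x₀ r) :=
      hG.continuousOn.comp continuous_eRealPt.continuousOn fun x hx => eRealPt_mem_ball hx
    have hG₁c : ContinuousOn (fun x : EuclideanSpace ℝ ι => G₁ (eRealPt x)) (Metric.ball x₀ r) :=
      hG₁d.continuousOn.comp continuous_eRealPt.continuousOn fun x hx => eRealPt_mem_ball hx
    -- integration by parts once
    have hparts := integral_bilinear_hasLineDerivAt_right_eq_neg_left_of_integrable (μ := volume)
      (B := ContinuousLinearMap.mul ℝ ℂ) (f := fun x => G (eRealPt x)) (f' := fun x => G₁ (eRealPt x))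
      (g := (ϕ : EuclideanSpace ℝ ι → ℂ)) (g' := fun x => (∂_{v} ϕ) x) (v := v) ?_ ?_ ?_ ?_ ?_
    · simp only [ContinuousLinearMap.mul_apply'] at hparts
      have ih := integral_comp_eRealPt_mul_iteratedLineDerivOp (Fin.tail J) hG₁d ψ hψ
      have htail : (fun i => EuclideanSpace.single (Fin.tail J i) (1 : ℝ)) =
          Fin.tail fun i => EuclideanSpace.single (J i) (1 : ℝ) := rfl
      rw [htail] at ih
      rw [hparts, ih, pow_succ]
      ring
    · refine Continuous.integrable_of_hasCompactSupport
        (continuous_mul_of_continuousOn_of_tsupport_subset hU hG₁c ϕ.continuous hϕsupp)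
        ((hasCompactSupport_of_tsupport_subset_ball hϕsupp).mul_left)
    · have hsupp' : tsupport (fun x => (∂_{v} ϕ) x) ⊆ Metric.ball x₀ r :=
        (tsupport_lineDerivOp_subset v ϕ).trans hϕsupp
      exact Continuous.integrable_of_hasCompactSupport
        (continuous_mul_of_continuousOn_of_tsupport_subset hU hGc (∂_{v} ϕ).continuous hsupp')
        ((hasCompactSupport_of_tsupport_subset_ball hsupp').mul_left)
    · exact Continuous.integrable_of_hasCompactSupport
        (continuous_mul_of_continuousOn_of_tsupport_subset hU hGc ϕ.continuous hϕsupp)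
        ((hasCompactSupport_of_tsupport_subset_ball hϕsupp).mul_left)
    · intro x hx
      have hxball : eRealPt x ∈ ball (eRealPt x₀) r := eRealPt_mem_ball (hϕsupp hx)
      exact hasLineDerivAt_comp_eRealPt (hG.differentiableAt (isOpen_ball.mem_nhds hxball)) (J 0)
    · intro x _
      have h := (ϕ.differentiableAt (x := x)).hasFDerivAt.hasLineDerivAt v
      rwa [← SchwartzMap.lineDerivOp_apply_eq_fderiv] at h

end Literature.Analysis.Complex
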